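import Literature.Combinatorics.AssociationSchemes.JohnsonHarmonics
import HarnessLib

/-!
# Cell pnp-psdrank, route `ChebyshevTracialDesign`: slice ladders — raising and lowering a harmonic layer
# between slices of the Boolean lattice acts by explicit scalars on the cube side

Harmonic backbone, brick 2 (MEMO-7 §1 (1b); the `𝒰`-factor of the saturation factorisation `E^{(a)} = 𝒰 ∘ B_{2a}`
of Rothvoß's level kernels). For a Johnson-harmonic coefficient vector `p` of degree `k`
(`Literature.Combinatorics.AssociationSchemes.JohnsonHarmonics`: `IsHarmonic k p`) and its cube evaluation `zeta p`:
* `sum_zeta_insert` : `Σ_{z ∉ V} zeta p (V ∪ z) = (n − |V| − k) · zeta p (V)` (one raising step between slices, from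
  `down p = 0` and `sum_powerset_insert`);
* `sum_supersets_zeta` : `Σ_{U ⊇ V, |U| = |V| + 1} zeta p (U) = (n − |V| − k) · zeta p (V)` (the same, indexed by supersets);
* `card_filter_powersetCard_superset` : `#{V : T ⊆ V ⊆ U, |V| = m} = C(|U| − |T|, m − |T|)`;
* `sum_subsets_zeta` : `Σ_{V ⊆ U, |V| = m} zeta p (V) = C(|U| − k, m − k) · zeta p (U)` for `p` homogeneous of degree
  `k ≤ m` (one or several lowering steps).
These are the incidence operators `𝒰(U,V) = 1[V ⊆ U]` between slices restricted to a harmonic layer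
[cite: GodsilMeagher2015, §6.2–6.3 (Johnson scheme; inclusion maps between layers)]; the scalars are the ones the
tight-kernel spectrum and the exact bi-mode expansion (MEMO-7 (★), (★★)) are assembled from. [cite: Rothvoss2017, §2 (PDF p. 6)]
WHAT THIS IS NOT: nothing on matchings or psd rank here. Supports crux stmt-PneNP-19878.
-/

set_option linter.dupNamespace false -- `Summit.PneNP.PneNP.…`: summit = sub-problem (D-0017)

noncomputable section

namespace Summit.PneNP.PneNP.Theorems.ChebyshevTracialDesignSliceLadders

open Finset Literature.Combinatorics.AssociationSchemes Literature.Combinatorics.AssociationSchemes.JohnsonHarmonics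

variable {n : ℕ}

/-! ### §1 One raising step -/

/-- For `T ⊆ V` and harmonic `p`: the fresh-point sum `Σ_{z ∉ V} p (T ∪ z)` equals minus the sum over the
points of `V \ T` (harmonicity `Σ_{z ∉ T} p (T ∪ z) = 0` split along `Tᶜ = Vᶜ ⊔ (V \ T)`). -/
theorem sum_compl_insert_eq_neg {k : ℕ} {p : Finset (Fin n) → ℝ} (hp : IsHarmonic k p) {T V : Finset (Fin n)}
    (hTV : T ⊆ V) : ∑ z ∈ Vᶜ, p (insert z T) = -∑ z ∈ V \ T, p (insert z T) := by
  have h0 : ∑ z ∈ Tᶜ, p (insert z T) = 0 := by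
    have := congrFun hp.2 T
    simpa [down_apply] using this
  have hsplit : Tᶜ = Vᶜ ∪ (V \ T) := by
    ext z
    simp only [mem_compl, mem_union, mem_sdiff]
    constructor
    · intro hz; by_cases hzV : z ∈ V
      · exact Or.inr ⟨hzV, hz⟩
      · exact Or.inl hzV
    · rintro (hz | ⟨-, hz⟩)
      · exact fun h => hz (hTV h)
      · exact hz
  have hdisj : Disjoint Vᶜ (V \ T) := disjoint_left.2 fun z hz hz' => (mem_compl.1 hz) (mem_sdiff.1 hz').1
  rw [hsplit, sum_union hdisj] at h0
  linarith

/-- `Σ_{T ⊆ V} Σ_{z ∈ V \ T} p (T ∪ z) = Σ_{S ⊆ V} |S| · p S` (re-index by `S = T ∪ z`). -/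
theorem sum_powerset_sum_sdiff_insert (p : Finset (Fin n) → ℝ) (V : Finset (Fin n)) :
    ∑ T ∈ V.powerset, ∑ z ∈ V \ T, p (insert z T) = ∑ S ∈ V.powerset, (S.card : ℝ) * p S := by
  rw [← sum_powerset_sum_mem_erase V (fun T z => p (insert z T))]
  refine sum_congr rfl fun S _ => ?_
  rw [sum_congr rfl fun z hz => by rw [insert_erase hz], sum_const, nsmul_eq_mul]

/-- **One raising step.** For `p` harmonic of degree `k` and any `V`:
`Σ_{z ∉ V} zeta p (V ∪ z) = (n − |V| − k) · zeta p (V)`. -/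
theorem sum_zeta_insert {k : ℕ} {p : Finset (Fin n) → ℝ} (hp : IsHarmonic k p) (V : Finset (Fin n)) :
    ∑ z ∈ Vᶜ, zeta p (insert z V) = ((n : ℝ) - V.card - k) * zeta p V := by
  have hstep : ∀ z ∈ Vᶜ, zeta p (insert z V) = zeta p V + ∑ T ∈ V.powerset, p (insert z T) := by
    intro z hz
    rw [zeta_apply, zeta_apply, sum_powerset_insert (mem_compl.1 hz)]
  rw [sum_congr rfl hstep, sum_add_distrib, sum_const, nsmul_eq_mul, card_compl, Fintype.card_fin, sum_comm]
  have hinner : ∀ T ∈ V.powerset, ∑ z ∈ Vᶜ, p (insert z T) = -∑ z ∈ V \ T, p (insert z T) :=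
    fun T hT => sum_compl_insert_eq_neg hp (mem_powerset.1 hT)
  rw [sum_congr rfl hinner, sum_neg_distrib, sum_powerset_sum_sdiff_insert]
  have hhom : ∑ S ∈ V.powerset, (S.card : ℝ) * p S = (k : ℝ) * zeta p V := by
    rw [zeta_apply, mul_sum]
    exact sum_congr rfl fun S _ => hp.1.mul_card_eq (fun m => (m : ℝ)) S
  rw [hhom, Nat.cast_sub (card_finset_fin_le V)]
  ring

/-- The `t`-sets containing a given `(t−1)`-set... in general: the supersets of `V` of size `|V| + 1` are the
sets `V ∪ z`, `z ∉ V`. -/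
theorem filter_powersetCard_succ_superset_eq_image (V : Finset (Fin n)) :
    (powersetCard (V.card + 1) (univ : Finset (Fin n))).filter (fun U => V ⊆ U) =
      (Vᶜ).image (fun z => insert z V) := by
  ext U
  simp only [mem_filter, mem_powersetCard, subset_univ, true_and, mem_image, mem_compl]
  constructor
  · rintro ⟨hcard, hVU⟩
    have h1 : (U \ V).card = 1 := by rw [card_sdiff_of_subset hVU, hcard]; simp
    obtain ⟨z, hz⟩ := card_eq_one.1 h1
    have hzU : z ∈ U \ V := by rw [hz]; exact mem_singleton_self z
    refine ⟨z, (mem_sdiff.1 hzU).2, ?_⟩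
    ext x
    simp only [mem_insert]
    constructor
    · rintro (rfl | hx)
      · exact (mem_sdiff.1 hzU).1
      · exact hVU hx
    · intro hxU
      by_cases hxV : x ∈ V
      · exact Or.inr hxV
      · left
        have : x ∈ U \ V := mem_sdiff.2 ⟨hxU, hxV⟩
        rw [hz] at this
        exact mem_singleton.1 this
  · rintro ⟨z, hz, rfl⟩
    exact ⟨card_insert_of_notMem hz, subset_insert z V⟩

/-- **One raising step, superset form.** For `p` harmonic of degree `k`:
`Σ_{U ⊇ V, |U| = |V|+1} zeta p (U) = (n − |V| − k) · zeta p (V)`. -/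
theorem sum_supersets_zeta {k : ℕ} {p : Finset (Fin n) → ℝ} (hp : IsHarmonic k p) (V : Finset (Fin n)) :
    ∑ U ∈ (powersetCard (V.card + 1) (univ : Finset (Fin n))).filter (fun U => V ⊆ U), zeta p U =
      ((n : ℝ) - V.card - k) * zeta p V := by
  rw [filter_powersetCard_succ_superset_eq_image, sum_image, sum_zeta_insert hp]
  intro z hz z' hz' h
  rw [mem_coe, mem_compl] at hz hz'
  have h' : insert z V = insert z' V := h
  have : z ∈ insert z' V := by rw [← h']; exact mem_insert_self z V
  rcases mem_insert.1 this with h' | h'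
  · exact h'
  · exact absurd h' hz

/-! ### §2 Lowering steps -/

/-- `#{V : T ⊆ V ⊆ U, |V| = m} = C(|U| − |T|, m − |T|)` for `T ⊆ U`, `|T| ≤ m`. -/
theorem card_filter_powersetCard_superset {T U : Finset (Fin n)} (hTU : T ⊆ U) {m : ℕ} (hm : T.card ≤ m) :
    ((powersetCard m U).filter (fun V => T ⊆ V)).card = (U.card - T.card).choose (m - T.card) := by
  rw [← card_sdiff_of_subset hTU, ← card_powersetCard (m - T.card) (U \ T)]
  refine card_nbij' (fun V => V \ T) (fun W => W ∪ T) ?_ ?_ ?_ ?_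
  · intro V hV
    simp only [mem_coe, mem_filter, mem_powersetCard] at hV ⊢
    obtain ⟨⟨hVU, hVm⟩, hTV⟩ := hV
    exact ⟨sdiff_subset_sdiff hVU le_rfl, by rw [card_sdiff_of_subset hTV, hVm]⟩
  · intro W hW
    simp only [mem_coe, mem_filter, mem_powersetCard] at hW ⊢
    obtain ⟨hWUT, hWm⟩ := hW
    have hdisj : Disjoint W T := disjoint_left.2 fun x hxW hxT => (mem_sdiff.1 (hWUT hxW)).2 hxT
    refine ⟨⟨union_subset (hWUT.trans sdiff_subset) hTU, ?_⟩, subset_union_right⟩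
    rw [card_union_of_disjoint hdisj, hWm]
    omega
  · intro V hV
    simp only [mem_coe, mem_filter, mem_powersetCard] at hV
    exact sdiff_union_of_subset hV.2
  · intro W hW
    simp only [mem_coe, mem_powersetCard] at hW
    have hdisj : Disjoint W T := disjoint_left.2 fun x hxW hxT => (mem_sdiff.1 (hW.1 hxW)).2 hxT
    exact union_sdiff_cancel_right hdisj

/-- **Lowering steps.** For `p` homogeneous of degree `k ≤ m` and any `U`:
`Σ_{V ⊆ U, |V| = m} zeta p (V) = C(|U| − k, m − k) · zeta p (U)`. -/
theorem sum_subsets_zeta {k m : ℕ} {p : Finset (Fin n) → ℝ} (hp : IsHomog k p) (hkm : k ≤ m) (U : Finset (Fin n)) :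
    ∑ V ∈ powersetCard m U, zeta p V = (((U.card - k).choose (m - k) : ℕ) : ℝ) * zeta p U := by
  simp only [zeta_apply]
  -- swap: `Σ_{V} Σ_{T ⊆ V} p T = Σ_{T ⊆ U} p T · #{V : T ⊆ V ⊆ U, |V| = m}`
  rw [sum_comm' (t' := U.powerset) (s' := fun T => (powersetCard m U).filter (fun V => T ⊆ V))]
  · rw [mul_sum]
    refine sum_congr rfl fun T hT => ?_
    rw [sum_const, nsmul_eq_mul]
    by_cases hTk : T.card = k
    · rw [card_filter_powersetCard_superset (mem_powerset.1 hT) (hTk ▸ hkm), hTk]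
    · rw [hp T hTk, mul_zero, mul_zero]
  · intro V T
    simp only [mem_powerset, mem_filter, mem_powersetCard]
    constructor
    · rintro ⟨⟨hVU, hVm⟩, hTV⟩
      exact ⟨⟨⟨hVU, hVm⟩, hTV⟩, hTV.trans hVU⟩
    · rintro ⟨⟨⟨hVU, hVm⟩, hTV⟩, -⟩
      exact ⟨⟨hVU, hVm⟩, hTV⟩

end Summit.PneNP.PneNP.Theorems.ChebyshevTracialDesignSliceLadders
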